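import Mathlib
import Summits.ABC.IUTFork.Joshi.LocalPeriodRings
import Summits.ABC.IUTFork.Joshi.LocalPeriodRingsModel
import HarnessLib

/-!
# The joint §5–§6 VACUITY MODEL: slot T-09's `PeriodRingTower` and `BEDatum` INSTANTIATED over the domain model
# `Model.towerDatum` (branch E, E-plan-2 ruling 2026-08-26T08:36:44Z (2) «`Joshi/LocalPeriodRingsModel.lean` = E-t9»)

Test-side support file of the abc-iut cell, branch E (rung LADDER-ABC:A2.E; seat abc-iut-E-t9). Over the second model
`Model.towerDatum p` of E-t3's `PeriodRingDatum` (`Joshi/LocalPeriodRingsModel.lean`: `B = Q̄_p[ℚ][S]`, an integral domain, Frobenius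
`S ↦ p·S`) this file instantiates EVERY field of `Summit.ABC.IUTFork.Joshi.ATS3.PeriodRingTower` (p429989; [J-III] §5.1–§5.2) and of
`PeriodRingTower.BEDatum` in the kernel, so that the theorems of `LocalPeriodRings.lean` / `LocalPeriodRingsProofs.lean` (and of the
T-10/T-11 files once reconciled onto these carriers) are statements about a NONEMPTY class of structures (CONVENTIONS §4 vacuity
smell). DICTIONARY: `B_dR := Ω := K'((S))` (Mathlib `LaurentSeries`, a field) with `K' := Frac(Q̄_p[ℚ])`; `B ↪ B_dR` the composite
`A[S] → K'[S] → K'⟦S⟧ → K'((S))` (three injective maps); `B⁺_dR := K'⟦S⟧` (Mathlib: a discrete valuation ring), `t := S` (so `(t)` is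
the maximal ideal and `B_dR = ⋃ₙ t⁻ⁿ B⁺_dR`, Mathlib's `IsLocalization (powers X) K⸨X⸩`); `B⁺_cris := B⁺_dR`, `B_cris := B⁺_dR[1/t]`;
the Frobenius of `B_cris` is the substitution `S ↦ p·S` (`PowerSeries.rescale p` lifted through the fraction field), which extends the
Frobenius of `B` and satisfies `φ(t) = p·t`; Galois trivial; the `p`-adic field of `BEDatum` is `E = E_0 = ℚ_p` (`⊥`), inside `B⁺`
(§5.2.1), with the Frobenius of `B_E = B` transported from `φ`. The model is LOGICAL (as O1 and file 2); it exhibits joint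
satisfiability of the typed §5 axioms with E-t3's §2 axioms, nothing more; no claim about any author's mathematics. [folklore]
-/

noncomputable section

open Polynomial

namespace Summit.ABC.IUTFork.Joshi.Model

variable (p : ℕ) [hp : Fact p.Prime]

/-- `K' := Frac(Q̄_p[ℚ])`, the coefficient field of the model `B_dR`. [folklore] -/
abbrev CoefField : Type := FractionRing (ExpAlg p)

/-- `Ω := K'((S))`, the model `B_dR` (a field). [folklore] -/
abbrev Omega : Type := LaurentSeries (CoefField p)

/-! ## 1. `B ↪ B_dR` -/

/-- The embedding `B = A[S] → K'[S] → K'⟦S⟧ → K'((S))` as a ring homomorphism. [folklore] -/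
def toBdRRingHom : TowerRing p →+* Omega p :=
  (HahnSeries.ofPowerSeries ℤ (CoefField p)).comp
    ((Polynomial.coeToPowerSeries.ringHom).comp (Polynomial.mapRingHom (algebraMap (ExpAlg p) (CoefField p))))

/-- Unfolding. [folklore] -/
theorem toBdRRingHom_apply (f : TowerRing p) :
    toBdRRingHom p f = HahnSeries.ofPowerSeries ℤ (CoefField p)
      ((f.map (algebraMap (ExpAlg p) (CoefField p)) : PowerSeries (CoefField p))) := rfl

/-- On constants: `C a ↦` the constant Laurent series `a`. [folklore] -/
theorem toBdRRingHom_C (a : ExpAlg p) :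
    toBdRRingHom p (C a) = HahnSeries.ofPowerSeries ℤ (CoefField p) (PowerSeries.C (algebraMap (ExpAlg p) (CoefField p) a)) := by
  rw [toBdRRingHom_apply, Polynomial.map_C, Polynomial.coe_C]

/-- On the variable: `S ↦ S`. [folklore] -/
theorem toBdRRingHom_X : toBdRRingHom p X = HahnSeries.ofPowerSeries ℤ (CoefField p) PowerSeries.X := by
  rw [toBdRRingHom_apply, Polynomial.map_X, Polynomial.coe_X]

/-- **`B ↪ B_dR` (5.2.4.2) as a `ℚ_p`-algebra map.** [folklore] -/
def toBdRAlg : TowerRing p →ₐ[ℚ_[p]] Omega p :=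
  { toBdRRingHom p with
    commutes' := fun q => by
      show toBdRRingHom p (algebraMap ℚ_[p] (TowerRing p) q) =
        HahnSeries.ofPowerSeries ℤ (CoefField p) (algebraMap ℚ_[p] (PowerSeries (CoefField p)) q)
      rw [Polynomial.algebraMap_apply, toBdRRingHom_C, ← IsScalarTower.algebraMap_apply, PowerSeries.algebraMap_apply] }

/-- Unfolding. [folklore] -/
theorem toBdRAlg_apply (f : TowerRing p) : toBdRAlg p f = toBdRRingHom p f := rfl

/-- **`B ↪ B_dR` is injective** (three injective maps). [folklore] -/
theorem toBdRAlg_injective : Function.Injective (toBdRAlg p) :=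
  HahnSeries.ofPowerSeries_injective.comp ((Polynomial.coe_injective _).comp
    (Polynomial.map_injective _ (IsFractionRing.injective (ExpAlg p) (CoefField p))))

/-! ## 2. `B⁺_dR = K'⟦S⟧ ⊂ B_dR`: a DVR with maximal ideal `(S)`, `B_dR = B⁺_dR[1/S]` -/

/-- `K'⟦S⟧ → K'((S))` as a `ℚ_p`-algebra map (the structure map of Mathlib's algebra instance). [folklore] -/
def psAlg : PowerSeries (CoefField p) →ₐ[ℚ_[p]] Omega p :=
  { HahnSeries.ofPowerSeries ℤ (CoefField p) with commutes' := fun _ => rfl }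

/-- Unfolding. [folklore] -/
theorem psAlg_apply (f : PowerSeries (CoefField p)) : psAlg p f = HahnSeries.ofPowerSeries ℤ (CoefField p) f := rfl

/-- **The model `B⁺_dR`**: the image of `K'⟦S⟧` in `K'((S))`. [folklore] -/
def BdRplusΩ : Subalgebra ℚ_[p] (Omega p) := (psAlg p).range

/-- `B` lands in `B⁺_dR` (polynomials are power series). [folklore] -/
theorem toBdRAlg_mem_BdRplusΩ (f : TowerRing p) : toBdRAlg p f ∈ BdRplusΩ p := ⟨_, rfl⟩

/-- `K'⟦S⟧ ≃ B⁺_dR`. [folklore] -/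
def psEquiv : PowerSeries (CoefField p) ≃ₐ[ℚ_[p]] BdRplusΩ p :=
  AlgEquiv.ofInjective (psAlg p) HahnSeries.ofPowerSeries_injective

/-- Unfolding. [folklore] -/
theorem coe_psEquiv (f : PowerSeries (CoefField p)) :
    ((psEquiv p f : BdRplusΩ p) : Omega p) = HahnSeries.ofPowerSeries ℤ (CoefField p) f := rfl

/-- **`B⁺_dR` is a discrete valuation ring** (Mathlib: `K'⟦S⟧` is a DVR; transport along `psEquiv`). [folklore] -/
theorem isDVR_BdRplusΩ : IsDiscreteValuationRing (BdRplusΩ p) :=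
  IsDiscreteValuationRing.RingEquivClass.isDiscreteValuationRing (psEquiv p)

/-- The ideal `(S) ⊂ B⁺_dR` is maximal (transport of `PowerSeries.maximalIdeal_eq_span_X`). [folklore] -/
theorem isMaximal_span_psX : (Ideal.span {psEquiv p PowerSeries.X}).IsMaximal := by
  let e := (psEquiv p).toRingEquiv
  have hmax : (Ideal.span {(PowerSeries.X : PowerSeries (CoefField p))}).IsMaximal := by
    rw [← PowerSeries.maximalIdeal_eq_span_X]; exact IsLocalRing.maximalIdeal.isMaximal _
  have h := Ideal.IsMaximal.map_bijective e.toRingHom e.bijective hmax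
  rwa [Ideal.map_span, Set.image_singleton] at h

/-- `B_dR = ⋃ₙ S⁻ⁿ B⁺_dR` (Mathlib: `K'((S))` is the localisation of `K'⟦S⟧` at the powers of `S`). [folklore] -/
theorem exists_X_pow_mul_mem (x : Omega p) :
    ∃ n : ℕ, toBdRAlg p X ^ n * x ∈ BdRplusΩ p := by
  obtain ⟨⟨a, ⟨y, hy⟩⟩, h⟩ := IsLocalization.surj (Submonoid.powers (PowerSeries.X : PowerSeries (CoefField p))) x
  obtain ⟨n, rfl⟩ := (Submonoid.mem_powers_iff _ _).1 hy
  have h' : x * (HahnSeries.ofPowerSeries ℤ (CoefField p) PowerSeries.X) ^ n =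
      HahnSeries.ofPowerSeries ℤ (CoefField p) a := by
    have h2 := h
    dsimp only at h2
    rwa [map_pow, LaurentSeries.coe_algebraMap] at h2
  refine ⟨n, ⟨a, ?_⟩⟩
  change HahnSeries.ofPowerSeries ℤ (CoefField p) a = _
  rw [← h', mul_comm, toBdRAlg_apply, toBdRRingHom_X]

/-- The model `B_cris := B⁺_cris[1/t]` with `B⁺_cris := B⁺_dR`. [folklore] -/
def Bcris : Subalgebra ℚ_[p] (Omega p) := Algebra.adjoin ℚ_[p] ((BdRplusΩ p : Set (Omega p)) ∪ {(toBdRAlg p X)⁻¹})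

/-! ## 3. The Frobenius `S ↦ p·S` on `B_dR`, `B_cris` and its compatibility with `φ` on `B` -/

/-- `(p : K') ≠ 0`. [folklore] -/
theorem natCast_p_ne_zero_coef : (p : CoefField p) ≠ 0 := by
  have hA : (p : ExpAlg p) ≠ 0 := by
    rw [AddMonoidAlgebra.natCast_def]
    exact AddMonoidAlgebra.single_ne_zero.2 (by exact_mod_cast hp.out.ne_zero)
  rw [← map_natCast (algebraMap (ExpAlg p) (CoefField p))]
  exact fun h => hA ((IsFractionRing.injective (ExpAlg p) (CoefField p)) (by rw [h, map_zero]))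

/-- The substitution `S ↦ p·S` on `K'⟦S⟧` (Mathlib `PowerSeries.rescale`). [folklore] -/
def rescaleP : PowerSeries (CoefField p) →+* PowerSeries (CoefField p) := PowerSeries.rescale (p : CoefField p)

/-- `S ↦ p·S` is injective on power series (coefficientwise multiplication by `pⁿ ≠ 0`). [folklore] -/
theorem rescaleP_injective : Function.Injective (rescaleP p) := fun f g h => by
  ext n
  have hn := congrArg (PowerSeries.coeff n) h
  rw [rescaleP, PowerSeries.coeff_rescale, PowerSeries.coeff_rescale] at hn
  exact mul_left_cancel₀ (pow_ne_zero n (natCast_p_ne_zero_coef p)) hn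

/-- `S ↦ p·S` fixes constants. [folklore] -/
theorem rescaleP_C (c : CoefField p) : rescaleP p (PowerSeries.C c) = PowerSeries.C c := by
  ext n
  rw [rescaleP, PowerSeries.coeff_rescale, PowerSeries.coeff_C]
  split_ifs with h
  · rw [h, pow_zero, one_mul]
  · rw [mul_zero]

/-- **The Frobenius of `B_dR = K'((S))`**: `S ↦ p·S`, the unique extension of `rescaleP` through the fraction field, as a ring
homomorphism. (A model convenience: Joshi's `B_dR` carries no Frobenius; the structure only asks for one on `B_cris`.) [folklore] -/
def frobΩRingHom : Omega p →+* Omega p :=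
  IsFractionRing.lift (g := (HahnSeries.ofPowerSeries ℤ (CoefField p)).comp (rescaleP p))
    (HahnSeries.ofPowerSeries_injective.comp (rescaleP_injective p))

/-- On power series the Frobenius is `rescaleP`. [folklore] -/
theorem frobΩRingHom_ofPowerSeries (f : PowerSeries (CoefField p)) :
    frobΩRingHom p (HahnSeries.ofPowerSeries ℤ (CoefField p) f) = HahnSeries.ofPowerSeries ℤ (CoefField p) (rescaleP p f) := by
  have h := IsFractionRing.lift_algebraMap (K := Omega p)
    (g := (HahnSeries.ofPowerSeries ℤ (CoefField p)).comp (rescaleP p))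
    (HahnSeries.ofPowerSeries_injective.comp (rescaleP_injective p)) f
  rw [LaurentSeries.coe_algebraMap] at h
  exact h

/-- The Frobenius of `B_dR` as a `ℚ_p`-algebra map (it fixes the constants). [folklore] -/
def frobΩ : Omega p →ₐ[ℚ_[p]] Omega p :=
  { frobΩRingHom p with
    commutes' := fun q => by
      show frobΩRingHom p (HahnSeries.ofPowerSeries ℤ (CoefField p) (algebraMap ℚ_[p] (PowerSeries (CoefField p)) q)) =
        HahnSeries.ofPowerSeries ℤ (CoefField p) (algebraMap ℚ_[p] (PowerSeries (CoefField p)) q)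
      rw [frobΩRingHom_ofPowerSeries, PowerSeries.algebraMap_apply, rescaleP_C] }

/-- Unfolding. [folklore] -/
theorem frobΩ_apply (x : Omega p) : frobΩ p x = frobΩRingHom p x := rfl

/-- `φ` maps `B⁺_dR` into itself. [folklore] -/
theorem frobΩ_mem_BdRplusΩ {x : Omega p} (hx : x ∈ BdRplusΩ p) : frobΩ p x ∈ BdRplusΩ p := by
  obtain ⟨f, rfl⟩ := hx
  refine ⟨rescaleP p f, ?_⟩
  change HahnSeries.ofPowerSeries ℤ (CoefField p) (rescaleP p f) = frobΩRingHom p (HahnSeries.ofPowerSeries ℤ (CoefField p) f)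
  rw [frobΩRingHom_ofPowerSeries]

/-- The image of `p` in `B_dR` is the constant power series `p`. [folklore] -/
theorem natCast_Omega_eq : (p : Omega p) = HahnSeries.ofPowerSeries ℤ (CoefField p) (PowerSeries.C (p : CoefField p)) := by
  rw [map_natCast, map_natCast]

/-- `(p : B_dR) ≠ 0`. [folklore] -/
theorem natCast_p_ne_zero_Omega : (p : Omega p) ≠ 0 := by
  rw [natCast_Omega_eq, Ne, ← map_zero (HahnSeries.ofPowerSeries ℤ (CoefField p)),
    HahnSeries.ofPowerSeries_injective.eq_iff, ← map_zero (PowerSeries.C (R := CoefField p)), (PowerSeries.C_injective).eq_iff]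
  exact natCast_p_ne_zero_coef p

/-- `φ(S) = p·S` in `B_dR`. [folklore] -/
theorem frobΩ_toBdR_X : frobΩ p (toBdRAlg p X) = (p : Omega p) * toBdRAlg p X := by
  rw [frobΩ_apply, toBdRAlg_apply, toBdRRingHom_X, frobΩRingHom_ofPowerSeries, rescaleP, PowerSeries.rescale_X, map_mul,
    natCast_Omega_eq]

/-- **`φ` on `B_dR` extends `φ` on `B`**: `φ_Ω ∘ (B ↪ B_dR) = (B ↪ B_dR) ∘ φ_B`. [folklore] -/
theorem frobΩ_toBdR (f : TowerRing p) : frobΩ p (toBdRAlg p f) = toBdRAlg p (frobEquivA p f) := by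
  suffices h : (frobΩRingHom p).comp (toBdRRingHom p) = (toBdRRingHom p).comp (frobEquivA p).toAlgHom.toRingHom from
    RingHom.congr_fun h f
  refine Polynomial.ringHom_ext (fun a => ?_) ?_
  · rw [RingHom.comp_apply, RingHom.comp_apply, toBdRRingHom_C, frobΩRingHom_ofPowerSeries, rescaleP_C]
    change _ = toBdRRingHom p (frobEquivA p (C a))
    rw [frobEquivA_apply, aeval_C, Polynomial.algebraMap_eq, toBdRRingHom_C]
  · rw [RingHom.comp_apply, RingHom.comp_apply]
    change frobΩ p (toBdRAlg p X) = toBdRRingHom p (frobEquivA p X)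
    rw [frobΩ_toBdR_X, frobEquivA_X, map_mul, map_natCast, toBdRAlg_apply]

/-- `(p : B_dR)⁻¹ ∈ B⁺_dR` (it is the constant `p⁻¹ ∈ K'`). [folklore] -/
theorem inv_natCast_mem_BdRplusΩ : (p : Omega p)⁻¹ ∈ BdRplusΩ p := by
  refine ⟨PowerSeries.C ((p : CoefField p)⁻¹), ?_⟩
  change HahnSeries.ofPowerSeries ℤ (CoefField p) (PowerSeries.C ((p : CoefField p)⁻¹)) = (p : Omega p)⁻¹
  symm
  apply inv_eq_of_mul_eq_one_right
  rw [natCast_Omega_eq, ← map_mul, ← map_mul, mul_inv_cancel₀ (natCast_p_ne_zero_coef p), map_one, map_one]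

/-- `φ` maps `B_cris` into itself (`φ(B⁺_dR) ⊆ B⁺_dR` and `φ(S⁻¹) = p⁻¹·S⁻¹`). [folklore] -/
theorem frobΩ_mem_Bcris {x : Omega p} (hx : x ∈ Bcris p) : frobΩ p x ∈ Bcris p := by
  have hsub : (Bcris p).map (frobΩ p) ≤ Bcris p := by
    rw [Bcris, AlgHom.map_adjoin]
    refine Algebra.adjoin_le ?_
    rintro _ ⟨y, hy, rfl⟩
    rcases hy with hy | hy
    · exact Algebra.subset_adjoin (Set.mem_union_left _ (frobΩ_mem_BdRplusΩ p hy))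
    · rw [Set.mem_singleton_iff] at hy
      subst hy
      rw [map_inv₀, frobΩ_toBdR_X, mul_inv]
      exact Subalgebra.mul_mem _ (Algebra.subset_adjoin (Set.mem_union_left _ (inv_natCast_mem_BdRplusΩ p)))
        (Algebra.subset_adjoin (Set.mem_union_right _ rfl))
  exact hsub ⟨x, hx, rfl⟩

/-- **The Frobenius of `B_cris`** (restriction of `φ`). [folklore] -/
def frobCris : Bcris p →ₐ[ℚ_[p]] Bcris p :=
  ((frobΩ p).comp (Bcris p).val).codRestrict (Bcris p) fun x => frobΩ_mem_Bcris p x.2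

/-- Unfolding. [folklore] -/
theorem coe_frobCris (x : Bcris p) : ((frobCris p x : Bcris p) : Omega p) = frobΩ p x := rfl

/-! ## 4. The model tower and its `BEDatum` -/

/-- The element `⟨S, _⟩ ∈ B⁺_dR` is the image of `X ∈ K'⟦S⟧` under `psEquiv`. [folklore] -/
theorem mk_toBdR_X_eq : (⟨toBdRAlg p X, toBdRAlg_mem_BdRplusΩ p X⟩ : BdRplusΩ p) = psEquiv p PowerSeries.X :=
  Subtype.ext (by rw [coe_psEquiv, Subtype.coe_mk, toBdRAlg_apply, toBdRRingHom_X])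

/-- **THE MODEL TOWER**: every field of `PeriodRingTower` ([J-III] §5.1–§5.2) instantiated over `towerDatum`. [folklore] -/
def towerModel : ATS3.PeriodRingTower (towerDatum p) p (Omega p) where
  p_eq := rfl
  toBdR := toBdRAlg p
  toBdR_injective := toBdRAlg_injective p
  t := X
  t_ne_zero := Polynomial.X_ne_zero
  BdRplus := BdRplusΩ p
  t_mem_BdRplus := toBdRAlg_mem_BdRplusΩ p X
  isDVR_BdRplus := isDVR_BdRplusΩ p
  isMaximal_span_t := by rw [mk_toBdR_X_eq]; exact isMaximal_span_psX p
  exists_t_pow_mul_mem := exists_X_pow_mul_mem p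
  Bcrisplus := BdRplusΩ p
  Bcris := Bcris p
  image_Bplus_subset_Bcrisplus := by rintro _ ⟨f, -, rfl⟩; exact toBdRAlg_mem_BdRplusΩ p f
  Bcris_eq_adjoin := rfl
  frobB := (frobEquivA p).restrictScalars ℚ_[p]
  frobB_apply _ := rfl
  frob_t := frobEquivA_X p
  frobCris := frobCris p
  frobCris_toBdR x _ h := by rw [coe_frobCris, Subtype.coe_mk, frobΩ_toBdR]; rfl
  galΩ := 1
  galΩ_toBdR _ _ := rfl

/-- In the model, `B_{ℚ_p} = B ⊔ ℚ_p = B` inside `B_dR`. [folklore] -/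
theorem BE_bot_eq : (towerModel p).BE ⊥ = (toBdRAlg p).range := by
  rw [ATS3.PeriodRingTower.BE, IntermediateField.bot_toSubalgebra, sup_bot_eq]; rfl

/-- `B ≃ B_{ℚ_p}` (onto the image). [folklore] -/
def rangeEquiv : TowerRing p ≃ₐ[ℚ_[p]] (toBdRAlg p).range := AlgEquiv.ofInjective _ (toBdRAlg_injective p)

/-- The Frobenius of `B_{ℚ_p} = B`, transported from `φ_B`. [folklore] -/
def frobBE : (towerModel p).BE ⊥ ≃ₐ[ℚ_[p]] (towerModel p).BE ⊥ :=
  (Subalgebra.equivOfEq _ _ (BE_bot_eq p)).trans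
    (((rangeEquiv p).symm.trans (((frobEquivA p).restrictScalars ℚ_[p]).trans (rangeEquiv p))).trans
      (Subalgebra.equivOfEq _ _ (BE_bot_eq p).symm))

/-- `ℚ_p ⊂ B⁺` in the model (§5.2.1): the constants `algebraMap q = C(T⁰·q)` have norm `≤ 1`. [folklore] -/
theorem algebraMap_mem_Bplus (q : ℚ_[p]) : algebraMap ℚ_[p] (TowerRing p) q ∈ (towerDatum p).Bplus := by
  rw [Polynomial.algebraMap_apply, AddMonoidAlgebra.coe_algebraMap, Function.comp_apply]
  exact C_single_zero_mem_Bplus p _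

/-- **THE MODEL `BEDatum`**: `E = E_0 = ℚ_p`. [folklore] -/
def towerBEDatum : (towerModel p).BEDatum where
  E := ⊥
  finiteDimensional := inferInstance
  E0 := ⊥
  E0_le := le_rfl
  E0_subset_Bplus := by
    intro x hx
    rw [SetLike.mem_coe, IntermediateField.mem_bot] at hx
    obtain ⟨q, rfl⟩ := hx
    exact ⟨algebraMap ℚ_[p] (TowerRing p) q, algebraMap_mem_Bplus p q, (toBdRAlg p).commutes q⟩
  frobBE := frobBE p
  frobBE_of_mem e he := by
    rw [IntermediateField.mem_bot] at he
    obtain ⟨q, rfl⟩ := he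
    have h : (⟨algebraMap ℚ_[p] (Omega p) q, (towerModel p).mem_BE_of_mem ⊥ (IntermediateField.mem_bot.2 ⟨q, rfl⟩)⟩ :
        (towerModel p).BE ⊥) = algebraMap ℚ_[p] ((towerModel p).BE ⊥) q := Subtype.ext rfl
    rw [h, AlgEquiv.commutes]; rfl

/-! ## 5. Non-vacuity, packaged -/

/-- **NON-VACUITY of the §5 tower over a domain model of the §2 signature**: `PeriodRingTower` and `BEDatum` are simultaneously
INSTANTIATED (at `p = 2`) over `towerDatum 2`. [folklore] -/
theorem tower_carriers_nonempty :
    Nonempty (ATS3.PeriodRingTower (towerDatum 2) 2 (Omega 2)) ∧ Nonempty ((towerModel 2).BEDatum) :=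
  ⟨⟨towerModel 2⟩, ⟨towerBEDatum 2⟩⟩

/-- Hence, e.g., the DERIVED theorem `BdRplus_ne_top` of `LocalPeriodRings.lean` speaks about a nonempty class: in the model
`B⁺_dR ⊊ B_dR`. [folklore] -/
theorem model_BdRplus_ne_top : (towerModel p).BdRplus ≠ ⊤ := (towerModel p).BdRplus_ne_top

/-- **HONEST-SCOPE NOTE, in kernel** (typer-side reader abc-iut-E-t50, AUDIT-p436997 INFO 1): the model's `|−|_ρ` is a
multiplicative ultrametric SEMI-norm whose kernel contains the ideal `(S)` — here `|t|_ρ = |S|_ρ = 0` although `t ≠ 0` and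
`toBdR t ≠ 0` — whereas in [FF18] `|−|_ρ` is a norm with `|p|_ρ = ρ`. E-t3's `PeriodRingDatum` records no definiteness /
`ρ`-dependence of the norms, so nothing TYPED is violated; the joint model exhibits satisfiability of the typed tower and nothing
more (the typed signature does not see `|t|_ρ`). [folklore] -/
theorem model_norm_t_eq_zero (ρ : ℝ) : (towerDatum p).norm ρ (towerModel p).t = 0 := by
  show ordNorm p ((X : TowerRing p).coeff 0) = 0
  rw [coeff_X_zero, ordNorm_zero]

end Summit.ABC.IUTFork.Joshi.Model

end
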